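/-
Copyright (c) 2026 the pub-hodgecm-mathlib formalisation cell (harness21).  Prover seat hodgecm-mathlib-K2Liu-p05 (g0): Track B «K2-LIT»,
#184♮ = hLiu418 = stmt-HodgeConjecture-24832; sockets #32d∕#32dR of `Cruxes/HLiu418/Lines/K2_Liu_CurveThetaSigs_U5d_ZetaS.lean` — the finite slice at a
place where `G_v` is compact (anisotropic `V_v`); K2/STATUS 2026-09-04 (K2Liu-p05 (g0)).
-/
import Summits.HodgeConjecture.HodgeConjecture.Theorems.K2LiuDoublingHeightDecayLocalOfSlices   -- ★ (R): the frame, `continuous_placesEmbed`, H5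
import HarnessLib

/-!
# Crux `HLiu418`, road `K2_Liu`, unit U5d, sockets #32d∕#32dR — THE FINITE SLICE AT A COMPACT PLACE

Cell `hodgecm-mathlib`, crux item hLiu418 = `stmt-HodgeConjecture-24832`; squad K2 ∕ K2Liu, LEAD F0P6-plan (g10), prover K2Liu-p05 (g0).  THEOREMS ONLY
(no `def` ∕ instance ∕ notation ∕ named-fact hypothesis ∕ `sorry`, default heartbeats); lane `--supports stmt-HodgeConjecture-24832 --as helper`.

`integrable_placeSlice_of_compactSpace`: in the frame of #32d, if `G_v = U(H)(L⁺_v)` is COMPACT (a non-split place `v ∈ S` at which `V_v` is anisotropic —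
for #32dR, `N = 2`, every non-split `v` with `V_v` non-hyperbolic), the finite slice `u ↦ Φ(ι(ιA(placesEmbed_S(1, u at v))))^τ` is integrable for EVERY real
`τ` (continuous on a compact group with a Haar, hence finite, measure) — the hypothesis `_hfin v` of ★ (R) `doublingHeightDecayLocal_of_slices` at such `v`.
Together with ★ `K2LiuSplitSliceIntegrable.integrable_placeSlice_split` (split `v`) only the quasi-split non-split places (`U(1,1)(L⁺_v)`, rank one) remain
for the finite half of #32dR.
[BorelJacquet1979, §4.1]; [PlatonovRapinchuk1994, §6.4 (anisotropic ⟹ compact)]; [Liu2011, §2C].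
HONEST LABEL.  Count-neutral helper: `HC_CM` is proved only modulo the 7 printed citations (2 remaining named inputs: hLiu418 = `stmt-HodgeConjecture-24832`,
h413 = `stmt-HodgeConjecture-24833`) until rung 0 closes.
-/

set_option autoImplicit false
-- the mandated namespace repeats the single-problem summit's segment (`HodgeConjecture.HodgeConjecture`)
set_option linter.dupNamespace false

noncomputable section

open NumberField IsDedekindDomain MeasureTheory

namespace Summit.HodgeConjecture.HodgeConjecture.Cruxes.HLiu418.K2LiuPlaceSliceCompact

open Literature.NumberTheory.Automorphic Literature.NumberTheory.Automorphic.UnitaryGroup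
open Literature.NumberTheory.GelbartRogawski1991 Literature.NumberTheory.GelbartRogawski1991.GRConstruction
open Literature.NumberTheory.K2Lit Literature.NumberTheory.K2Lit.SiegelDoubled Literature.NumberTheory.K2Lit.PlaceSplitting
open Summit.HodgeConjecture.HodgeConjecture.Cruxes.HLiu418.K2LiuDoublingUnfoldBridge

variable (L : Type) [Field L] [NumberField L] [IsCMField L]
variable {N M n : ℕ} (e : Fin N × Fin M ≃ Fin n)
  (dV : Fin N → L) (hdV : ∀ i, IsCMField.complexConj L (dV i) = dV i)
  (dW : Fin M → L) (hdW : ∀ i, IsCMField.complexConj L (dW i) = dW i)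
  (H : Matrix (Fin N) (Fin N) L) (t : L) (ht : t ≠ 0) (g : GL (Fin N) L)
  (hg : formCongr ((IsCMField.complexConj L : L ≃ₐ[↥(maximalRealSubfield L)] L) : L →+* L) g (t • H) = Matrix.diagonal dV)
  (ιA : (UnitaryGroup.adelicGroupData (Fp L) L (IsCMField.complexConj L) N H).Adelic →*
    UnitaryGroup.adelic (Fp L) L (IsCMField.complexConj L) N (Matrix.diagonal dV))
  (hιA : ∀ k, ((ιA k : ↥(UnitaryGroup.adelic (Fp L) L (IsCMField.complexConj L) N (Matrix.diagonal dV))) :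
        GL (Fin N) (AdeleRing (𝓞 L) L)) =
      (toAdeleGL L g)⁻¹ * UnitaryGroup.adelicVal (Fp L) L (IsCMField.complexConj L) N H k * toAdeleGL L g)
  (S : Finset (HeightOneSpectrum (𝓞 (Fp L)))) [DecidableEq (HeightOneSpectrum (𝓞 (Fp L)))]

include ht hg hιA in
/-- **THE FINITE SLICE OF #32d∕#32dR AT A COMPACT PLACE**: if `U(H)(L⁺_v)` is compact, `u ↦ Φ(ι(ιA(placesEmbed_S(1, u at v))))^τ` is `ν`-integrable for every
real `τ` and every Haar measure `ν` (continuous integrand — ★ H5 `exists_continuousMulEquiv_eq_iotaA`, ★ `continuous_placesEmbed`, ★ `continuous_iotaLeft` — on a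
compact space with finite measure). [cite: BorelJacquet1979, §4.1] [cite: PlatonovRapinchuk1994, §6.4] -/
theorem integrable_placeSlice_of_compactSpace (v : S)
    [MeasurableSpace (UnitaryGroup.localPi L (IsCMField.complexConj L) N H v.1)]
    [BorelSpace (UnitaryGroup.localPi L (IsCMField.complexConj L) N H v.1)]
    [CompactSpace (UnitaryGroup.localPi L (IsCMField.complexConj L) N H v.1)]
    (ν : Measure (UnitaryGroup.localPi L (IsCMField.complexConj L) N H v.1)) [ν.IsHaarMeasure]
    {Φ : HA L e dV hdV dW hdW → ℝ} (hΦc : Continuous Φ) (hΦpos : ∀ x, 0 < Φ x) (τ : ℝ) :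
    Integrable (fun u => Φ (iotaLeft L e dV hdV dW hdW (ιA (placesEmbed L H S (1, Pi.mulSingle v u)))) ^ τ) ν := by
  obtain ⟨Ψ, -, hΨ⟩ := exists_continuousMulEquiv_eq_iotaA L H dV t ht g hg ιA hιA
  have hιc : Continuous ιA := by
    have h : (ιA : _ → _) = Ψ := funext fun x => (hΨ x).symm
    rw [h]
    exact Ψ.continuous
  have hslc : Continuous fun u : UnitaryGroup.localPi L (IsCMField.complexConj L) N H v.1 =>
      Φ (iotaLeft L e dV hdV dW hdW (ιA (placesEmbed L H S (1, Pi.mulSingle v u)))) ^ τ :=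
    (hΦc.comp ((continuous_iotaLeft L e dV hdV dW hdW).comp (hιc.comp ((continuous_placesEmbed L H S).comp (continuous_const.prodMk
      (continuous_mulSingle (A := fun w : S => UnitaryGroup.localPi L (IsCMField.complexConj L) N H w.1) v)))))).rpow_const
      fun x => Or.inl (hΦpos _).ne'
  exact hslc.integrable_of_hasCompactSupport (HasCompactSupport.of_compactSpace _)

end Summit.HodgeConjecture.HodgeConjecture.Cruxes.HLiu418.K2LiuPlaceSliceCompact

end
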